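import Summits.QuantumFields.YangMills.Theorems.FluctuationComparisonRegPrIntLS2BetaWhitneyHatCurl
import Summits.QuantumFields.YangMills.Theorems.FluctuationComparisonRegPrIntLS2BetaGeodesicJensenLift
import HarnessLib

/-!
# S2β · `hFlat` road, (F3) in `ℓ²` — THE DISCRETE WHITNEY IDENTITY, SQUARED AND SUMMED OVER A LEVEL: `Σ_x ‖d a (x;μ,κ)‖² ≤ L^{d−2}·Σ_y ‖d A (y;μ,κ)‖²`
# (Jensen per position with the cube-column weights, then their COLUMN MASS `Σ_x W(x,y) = L^d` EXACTLY)

Cell `ym3-torus` (rung R3 = continuum `SU(2)` Yang–Mills on the three-torus — NOT d = 4, NOT infinite volume, NOT a mass gap, NOT Clay).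
Width seat «width 12» `ym3-torus-px12` (gen 23), FREE px helper on crux `stmt-QuantumFields-20520` (`Theses.UnitScaleTilt.FluctuationComparisonRegPrIntL`),
count-neutral, DEFINITION-FREE (weights pinned by ✓`…S2BetaWhitneyHatWeights`' formula `hw`; fine form by `ha : a b = Σ_e w b e • A e`; cube-column weights written out).

WHY.  px17 g19's door ✓p816498 `…HFlatOfRelativeLetter` reduces `hFlat` to ONE one-level letter (H) in `ℓ²`; its (F3) feeder is the curvature of the hat-lift background
`U₀ := V` in `ℓ²` over the level (px13 g22 ✓`…RelativeFieldSquareSumPlaq.sq_sum_le_plaq`: `Σ_p dist1 (plaqHol U₀ p)²`).  ✓`…WhitneyHatCurl.lincurl_hat_eq` gives the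
linearised fine curl as `L⁻¹ ×` a CONVEX combination of coarse curls; this file squares it (Jensen) and sums it over the level, where the only count needed is the column
mass of the cube-column weights — obtained, like ✓`sum_hatW_eq_pow`, by DOUBLE COUNTING (the partition of unity ✓`sum_colW_eq_one` summed over the `(N′L)^d` fine sites
against coarse translation invariance over the `N′^d` centres), with NO box or multiplicity estimate.  The companion `…S2BetaWhitneyHatLiftCurvatureSq` puts the
`SU(2)` variables on it.

CONTENTS.  §1 ★★`lincurl_hat_eq_ordered` (the identity for an ORDERED pair `μ ≠ κ` — the unit-rectangle word, either orientation); §2 ★★`sq_norm_lincurl_hat_le`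
(`‖da(x)‖² ≤ L⁻²·Σ_y W(x,y)·‖dA(y)‖²`, ✓(ii-a) `sq_norm_sum_smul_le`); §3 `colW_congr`, `sum_colW_src_eq`, ★★`sum_colW_eq_pow` (`Σ_x W(x,y) = L^d`),
★★★`sum_sq_norm_lincurl_hat_le` (`Σ_x ‖da(x;μ,κ)‖² ≤ (L⁻¹)²·L^d·Σ_y ‖dA(y;μ,κ)‖²`); §4 bookkeeping for the companion: `sum_shift_eq`, `sum_four_slots_eq`
(`Σ_x (h⟨x,μ⟩ + h⟨x+e_μ,κ⟩ + h⟨x+e_κ,μ⟩ + h⟨x,κ⟩) = 2·Σ_x (h⟨x,μ⟩ + h⟨x,κ⟩)`), `sum_ne_pair_eq`∕`sum_pairs_eq`∕`sum_pairs_add_eq` (`Σ_{μ≠κ}(f μ + f κ) = 2(d−1)Σ f`),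
`sum_positions_eq` (position sums `(x; μ ≠ κ)` = plane sums of site sums, in px13's `Site × Fin d × Fin d` currency).

HONEST SCOPE.  Finite sums; no group, no analysis; nothing of Bałaban's is asserted ([Balaban1985RegularSpaces] (1.29) p.81 ∕ [Balaban1984PropagatorsI] (1.7) p.18 = printed loci
served); `hFlat`, TUBE-REG∘, GAP♯∘, S2β, crux 20520, `YM3TorusSU2` NOT proved; no registered stub closed; the Yang–Mills mass gap is NOT proved.
References: T. Bałaban, CMP **99** (1985) [Balaban1985RegularSpaces]; CMP **95** (1984) [Balaban1984PropagatorsI].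
-/

set_option autoImplicit false

namespace Summit.QuantumFields.YangMills.Theorems.FluctuationComparisonRegPrIntLS2BetaWhitneyHatCurlSq

open Finset
open Literature.MathematicalPhysics.QuantumFieldTheory.Balaban1983to89
open B10Eq27TorusAxialLog (rel rel_apply)
open Summit.QuantumFields.YangMills.Theorems.FluctuationComparisonRegPrIntLS2BetaWhitneyHatCurl
  (sub_shift_hat_eq colW_nonneg sum_colW_eq_one)
open Summit.QuantumFields.YangMills.Theorems.FluctuationComparisonRegPrIntLS2BetaGeodesicJensenLift (sq_norm_sum_smul_le)

variable {P : Params} {t : ℕ}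

/-! ## §1 The discrete Whitney identity for an ORDERED pair of distinct directions -/

section Ordered

variable {E : Type*} [AddCommGroup E] [Module ℝ E]

/-- ★★ `lincurl_hat_eq` of ✓`…WhitneyHatCurl` for an ORDERED pair `μ ≠ κ` (the word of the unit rectangle `R_{μκ}`; for `κ < μ` this is the inverse plaquette):
`a⟨x,μ⟩ + a⟨x+e_μ,κ⟩ − a⟨x+e_κ,μ⟩ − a⟨x,κ⟩ = L⁻¹ • Σ_y W(x,y) • (A⟨y,μ⟩ + A⟨y+e_μ,κ⟩ − A⟨y+e_κ,μ⟩ − A⟨y,κ⟩)`. [folklore] -/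
theorem lincurl_hat_eq_ordered (ht : t + 1 ≤ P.m + P.K) (w : PBond P t → PBond P (t + 1) → ℝ)
    (hw : ∀ b e, w b e = if e.dir = b.dir ∧ (b.src b.dir - emb e.src b.dir).val < P.L then
      ∏ ν ∈ Finset.univ.erase b.dir, max 0 (1 - ((rel (emb e.src) b.src ν).natAbs : ℝ) / P.L) else 0)
    (A : PBond P (t + 1) → E) (a : PBond P t → E) (ha : ∀ b, a b = ∑ e, w b e • A e) (x : Site P t) {μ κ : Fin P.d} (hμκ : μ ≠ κ) :
    a ⟨x, μ⟩ + a ⟨x.shift μ, κ⟩ - a ⟨x.shift κ, μ⟩ - a ⟨x, κ⟩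
      = (P.L : ℝ)⁻¹ • ∑ y : Site P (t + 1), ((if (x μ - emb y μ).val < P.L then (1 : ℝ) else 0) *
          (∏ ι ∈ (Finset.univ.erase μ).erase κ, max 0 (1 - ((rel (emb y) x ι).natAbs : ℝ) / P.L)) *
          (if (x κ - emb y κ).val < P.L then (1 : ℝ) else 0)) •
          (A ⟨y, μ⟩ + A ⟨y.shift μ, κ⟩ - A ⟨y.shift κ, μ⟩ - A ⟨y, κ⟩) := by
  have h1 := sub_shift_hat_eq ht w hw A a ha x hμκ.symm
  have h2 := sub_shift_hat_eq ht w hw A a ha x hμκ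
  rw [show a ⟨x, μ⟩ + a ⟨x.shift μ, κ⟩ - a ⟨x.shift κ, μ⟩ - a ⟨x, κ⟩
      = (a ⟨x, μ⟩ - a ⟨x.shift κ, μ⟩) - (a ⟨x, κ⟩ - a ⟨x.shift μ, κ⟩) by abel, h1, h2, ← smul_sub, ← Finset.sum_sub_distrib]
  congr 1
  refine Finset.sum_congr rfl fun y _ => ?_
  rw [Finset.erase_right_comm (a := κ),
    show (if (x κ - emb y κ).val < P.L then (1 : ℝ) else 0) *
        (∏ ι ∈ (Finset.univ.erase μ).erase κ, max 0 (1 - ((rel (emb y) x ι).natAbs : ℝ) / P.L)) *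
        (if (x μ - emb y μ).val < P.L then (1 : ℝ) else 0)
      = (if (x μ - emb y μ).val < P.L then (1 : ℝ) else 0) *
        (∏ ι ∈ (Finset.univ.erase μ).erase κ, max 0 (1 - ((rel (emb y) x ι).natAbs : ℝ) / P.L)) *
        (if (x κ - emb y κ).val < P.L then (1 : ℝ) else 0) by ring, ← smul_sub]
  congr 1
  abel

end Ordered

/-! ## §2 Jensen: the SQUARED fine curl is `L⁻²` times the column-weighted mean of the squared coarse curls -/

section Jensen

variable {E : Type*} [NormedAddCommGroup E] [NormedSpace ℝ E]

/-- ★★ **`‖d a (x;μ,κ)‖² ≤ L⁻² · Σ_y W(x,y) · ‖d A (y;μ,κ)‖²`** (the identity of §1, then Jensen for `‖·‖²` with the convex weights `W`, ✓(ii-a) `sq_norm_sum_smul_le`).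
[folklore] -/
theorem sq_norm_lincurl_hat_le (ht : t + 1 ≤ P.m + P.K) (w : PBond P t → PBond P (t + 1) → ℝ)
    (hw : ∀ b e, w b e = if e.dir = b.dir ∧ (b.src b.dir - emb e.src b.dir).val < P.L then
      ∏ ν ∈ Finset.univ.erase b.dir, max 0 (1 - ((rel (emb e.src) b.src ν).natAbs : ℝ) / P.L) else 0)
    (A : PBond P (t + 1) → E) (a : PBond P t → E) (ha : ∀ b, a b = ∑ e, w b e • A e) (x : Site P t) {μ κ : Fin P.d} (hμκ : μ ≠ κ) :
    ‖a ⟨x, μ⟩ + a ⟨x.shift μ, κ⟩ - a ⟨x.shift κ, μ⟩ - a ⟨x, κ⟩‖ ^ 2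
      ≤ ((P.L : ℝ)⁻¹) ^ 2 * ∑ y : Site P (t + 1), ((if (x μ - emb y μ).val < P.L then (1 : ℝ) else 0) *
          (∏ ι ∈ (Finset.univ.erase μ).erase κ, max 0 (1 - ((rel (emb y) x ι).natAbs : ℝ) / P.L)) *
          (if (x κ - emb y κ).val < P.L then (1 : ℝ) else 0)) *
          ‖A ⟨y, μ⟩ + A ⟨y.shift μ, κ⟩ - A ⟨y.shift κ, μ⟩ - A ⟨y, κ⟩‖ ^ 2 := by
  rw [lincurl_hat_eq_ordered ht w hw A a ha x hμκ, norm_smul, mul_pow, Real.norm_eq_abs, sq_abs]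
  exact mul_le_mul_of_nonneg_left (sq_norm_sum_smul_le Finset.univ (fun y _ => colW_nonneg x μ κ y) (sum_colW_eq_one ht x hμκ) _)
    (sq_nonneg _)

end Jensen

/-! ## §3 The column MASS of the cube-column weights: `Σ_x W(x, y) = L^d` EXACTLY (translation invariance + double counting) -/

section Mass

/-- `W` is a function of the coordinatewise differences `x − centre(y)` only. [folklore] -/
theorem colW_congr {x x' : Site P t} {y y' : Site P (t + 1)} (μ κ : Fin P.d) (hdiff : ∀ ι, x' ι - emb y' ι = x ι - emb y ι) :
    (if (x' μ - emb y' μ).val < P.L then (1 : ℝ) else 0) *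
        (∏ ι ∈ (Finset.univ.erase μ).erase κ, max 0 (1 - ((rel (emb y') x' ι).natAbs : ℝ) / P.L)) *
        (if (x' κ - emb y' κ).val < P.L then (1 : ℝ) else 0)
      = (if (x μ - emb y μ).val < P.L then (1 : ℝ) else 0) *
        (∏ ι ∈ (Finset.univ.erase μ).erase κ, max 0 (1 - ((rel (emb y) x ι).natAbs : ℝ) / P.L)) *
        (if (x κ - emb y κ).val < P.L then (1 : ℝ) else 0) := by
  simp only [rel_apply, hdiff]

/-- **Coarse translation invariance of the column mass**: `Σ_x W(x, y′) = Σ_x W(x, y)`. [folklore] -/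
theorem sum_colW_src_eq (μ κ : Fin P.d) (y y' : Site P (t + 1)) :
    ∑ x : Site P t, (if (x μ - emb y' μ).val < P.L then (1 : ℝ) else 0) *
        (∏ ι ∈ (Finset.univ.erase μ).erase κ, max 0 (1 - ((rel (emb y') x ι).natAbs : ℝ) / P.L)) *
        (if (x κ - emb y' κ).val < P.L then (1 : ℝ) else 0)
      = ∑ x : Site P t, (if (x μ - emb y μ).val < P.L then (1 : ℝ) else 0) *
        (∏ ι ∈ (Finset.univ.erase μ).erase κ, max 0 (1 - ((rel (emb y) x ι).natAbs : ℝ) / P.L)) *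
        (if (x κ - emb y κ).val < P.L then (1 : ℝ) else 0) := by
  refine (Fintype.sum_equiv (⟨fun x ι => x ι + (emb y' ι - emb y ι), fun x ι => x ι - (emb y' ι - emb y ι),
    fun x => funext fun ι => add_sub_cancel_right _ _, fun x => funext fun ι => sub_add_cancel _ _⟩ : Site P t ≃ Site P t) _ _ fun x => ?_).symm
  refine (colW_congr (x := x) (x' := fun ι => x ι + (emb y' ι - emb y ι)) (y := y) (y' := y') μ κ fun ι => ?_).symm
  show x ι + (emb y' ι - emb y ι) - emb y' ι = x ι - emb y ι
  ring

/-- ★★ **THE COLUMN MASS IS `L^d`**: `Σ_{x : T^{(t)}} W(x, y) = L^d` for every centre `y` (`μ ≠ κ`, standing range) — summing the partition of unity ✓`sum_colW_eq_one` over the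
`(N′L)^d` fine sites and using translation invariance over the `N′^d` centres. [folklore] -/
theorem sum_colW_eq_pow (ht : t + 1 ≤ P.m + P.K) {μ κ : Fin P.d} (hμκ : μ ≠ κ) (y : Site P (t + 1)) :
    ∑ x : Site P t, (if (x μ - emb y μ).val < P.L then (1 : ℝ) else 0) *
        (∏ ι ∈ (Finset.univ.erase μ).erase κ, max 0 (1 - ((rel (emb y) x ι).natAbs : ℝ) / P.L)) *
        (if (x κ - emb y κ).val < P.L then (1 : ℝ) else 0) = (P.L : ℝ) ^ P.d := by
  have h2 : ∑ y' : Site P (t + 1), ∑ x : Site P t, (if (x μ - emb y' μ).val < P.L then (1 : ℝ) else 0) *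
        (∏ ι ∈ (Finset.univ.erase μ).erase κ, max 0 (1 - ((rel (emb y') x ι).natAbs : ℝ) / P.L)) *
        (if (x κ - emb y' κ).val < P.L then (1 : ℝ) else 0) = Fintype.card (Site P t) := by
    rw [Finset.sum_comm]
    calc _ = ∑ _x : Site P t, (1 : ℝ) := Finset.sum_congr rfl fun x _ => sum_colW_eq_one ht x hμκ
      _ = Fintype.card (Site P t) := by rw [Finset.sum_const, Finset.card_univ, nsmul_eq_mul, mul_one]
  have h3 : ∑ y' : Site P (t + 1), ∑ x : Site P t, (if (x μ - emb y' μ).val < P.L then (1 : ℝ) else 0) *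
        (∏ ι ∈ (Finset.univ.erase μ).erase κ, max 0 (1 - ((rel (emb y') x ι).natAbs : ℝ) / P.L)) *
        (if (x κ - emb y' κ).val < P.L then (1 : ℝ) else 0)
      = Fintype.card (Site P (t + 1)) * ∑ x : Site P t, (if (x μ - emb y μ).val < P.L then (1 : ℝ) else 0) *
        (∏ ι ∈ (Finset.univ.erase μ).erase κ, max 0 (1 - ((rel (emb y) x ι).natAbs : ℝ) / P.L)) *
        (if (x κ - emb y κ).val < P.L then (1 : ℝ) else 0) := by
    rw [Finset.sum_congr rfl fun y' _ => sum_colW_src_eq μ κ y y', Finset.sum_const, Finset.card_univ, nsmul_eq_mul]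
  have hcard : (Fintype.card (Site P t) : ℝ) = (P.L : ℝ) ^ P.d * Fintype.card (Site P (t + 1)) := by
    rw [Site.card_site_eq_mul_succ ht]; push_cast; ring
  have hpos : (0 : ℝ) < Fintype.card (Site P (t + 1)) := by exact_mod_cast Fintype.card_pos
  have key := h3.symm.trans (h2.trans hcard)
  rw [mul_comm ((P.L : ℝ) ^ P.d)] at key
  exact mul_left_cancel₀ hpos.ne' key

/-- ★★★ **THE SQUARED FINE CURLS OF A LEVEL, SUMMED: `Σ_x ‖d a (x;μ,κ)‖² ≤ L^{d−2} · Σ_y ‖d A (y;μ,κ)‖²`** (`μ ≠ κ`): Jensen per fine position, then the column mass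
`L^d` — with `A = L⁻¹ • log X` the right side carries another `L⁻²`. [folklore] -/
theorem sum_sq_norm_lincurl_hat_le {E : Type*} [NormedAddCommGroup E] [NormedSpace ℝ E] (ht : t + 1 ≤ P.m + P.K)
    (w : PBond P t → PBond P (t + 1) → ℝ)
    (hw : ∀ b e, w b e = if e.dir = b.dir ∧ (b.src b.dir - emb e.src b.dir).val < P.L then
      ∏ ν ∈ Finset.univ.erase b.dir, max 0 (1 - ((rel (emb e.src) b.src ν).natAbs : ℝ) / P.L) else 0)
    (A : PBond P (t + 1) → E) (a : PBond P t → E) (ha : ∀ b, a b = ∑ e, w b e • A e) {μ κ : Fin P.d} (hμκ : μ ≠ κ) :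
    ∑ x : Site P t, ‖a ⟨x, μ⟩ + a ⟨x.shift μ, κ⟩ - a ⟨x.shift κ, μ⟩ - a ⟨x, κ⟩‖ ^ 2
      ≤ ((P.L : ℝ)⁻¹) ^ 2 * (P.L : ℝ) ^ P.d * ∑ y : Site P (t + 1), ‖A ⟨y, μ⟩ + A ⟨y.shift μ, κ⟩ - A ⟨y.shift κ, μ⟩ - A ⟨y, κ⟩‖ ^ 2 := by
  calc _ ≤ ∑ x : Site P t, ((P.L : ℝ)⁻¹) ^ 2 * ∑ y : Site P (t + 1), ((if (x μ - emb y μ).val < P.L then (1 : ℝ) else 0) *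
          (∏ ι ∈ (Finset.univ.erase μ).erase κ, max 0 (1 - ((rel (emb y) x ι).natAbs : ℝ) / P.L)) *
          (if (x κ - emb y κ).val < P.L then (1 : ℝ) else 0)) *
          ‖A ⟨y, μ⟩ + A ⟨y.shift μ, κ⟩ - A ⟨y.shift κ, μ⟩ - A ⟨y, κ⟩‖ ^ 2 :=
        Finset.sum_le_sum fun x _ => sq_norm_lincurl_hat_le ht w hw A a ha x hμκ
    _ = ((P.L : ℝ)⁻¹) ^ 2 * ∑ y : Site P (t + 1), (∑ x : Site P t, (if (x μ - emb y μ).val < P.L then (1 : ℝ) else 0) *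
          (∏ ι ∈ (Finset.univ.erase μ).erase κ, max 0 (1 - ((rel (emb y) x ι).natAbs : ℝ) / P.L)) *
          (if (x κ - emb y κ).val < P.L then (1 : ℝ) else 0)) *
          ‖A ⟨y, μ⟩ + A ⟨y.shift μ, κ⟩ - A ⟨y.shift κ, μ⟩ - A ⟨y, κ⟩‖ ^ 2 := by
        rw [← Finset.mul_sum, Finset.sum_comm]
        congr 1
        refine Finset.sum_congr rfl fun y _ => ?_
        rw [Finset.sum_mul]
    _ = ((P.L : ℝ)⁻¹) ^ 2 * (P.L : ℝ) ^ P.d * ∑ y : Site P (t + 1), ‖A ⟨y, μ⟩ + A ⟨y.shift μ, κ⟩ - A ⟨y.shift κ, μ⟩ - A ⟨y, κ⟩‖ ^ 2 := by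
        have hcol : ∀ y : Site P (t + 1), ∑ x : Site P t, (if (x μ - emb y μ).val < P.L then (1 : ℝ) else 0) *
            (∏ ι ∈ (Finset.univ.erase μ).erase κ, max 0 (1 - ((rel (emb y) x ι).natAbs : ℝ) / P.L)) *
            (if (x κ - emb y κ).val < P.L then (1 : ℝ) else 0) = (P.L : ℝ) ^ P.d := fun y => sum_colW_eq_pow ht hμκ y
        simp_rw [hcol]
        rw [← Finset.mul_sum, mul_assoc]

end Mass


/-! ## §4 Bookkeeping: slots around a position, ordered pairs of directions, position sums -/

section Bookkeeping


/-- Shifting the position is a bijection of the torus: `Σ_x f (x + e_μ) = Σ_x f x`. [folklore] -/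
theorem sum_shift_eq {s : ℕ} (μ : Fin P.d) (f : Site P s → ℝ) : ∑ x : Site P s, f (x.shift μ) = ∑ x : Site P s, f x :=
  Fintype.sum_equiv ⟨fun x => x.shift μ, fun x => x.unshift μ, fun x => Site.unshift_shift x μ, fun x => Site.shift_unshift x μ⟩ _ _
    fun _ => rfl

/-- **The four bonds around the positions, summed**: `Σ_x (h⟨x,μ⟩ + h⟨x+e_μ,κ⟩ + h⟨x+e_κ,μ⟩ + h⟨x,κ⟩) = 2·Σ_x (h⟨x,μ⟩ + h⟨x,κ⟩)`. [folklore] -/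
theorem sum_four_slots_eq {s : ℕ} (h : PBond P s → ℝ) (μ κ : Fin P.d) :
    ∑ x : Site P s, (h ⟨x, μ⟩ + h ⟨x.shift μ, κ⟩ + h ⟨x.shift κ, μ⟩ + h ⟨x, κ⟩) = 2 * ∑ x : Site P s, (h ⟨x, μ⟩ + h ⟨x, κ⟩) := by
  simp only [Finset.sum_add_distrib]
  rw [sum_shift_eq μ (fun x => h ⟨x, κ⟩), sum_shift_eq κ (fun x => h ⟨x, μ⟩)]
  ring

/-- Sums over ordered pairs of distinct directions of a symmetric two-slot function: `Σ_{μ ≠ κ} (f μ + f κ) = 2(d−1)·Σ_μ f μ`. [folklore] -/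
theorem sum_ne_pair_eq (f : Fin P.d → ℝ) :
    ∑ μ : Fin P.d, ∑ κ : Fin P.d, (if μ ≠ κ then f μ + f κ else 0) = 2 * ((P.d : ℝ) - 1) * ∑ μ : Fin P.d, f μ := by
  have h : ∀ μ : Fin P.d, ∑ κ : Fin P.d, (if μ ≠ κ then f μ + f κ else 0) = ((P.d : ℝ) - 1) * f μ + (∑ κ, f κ - f μ) := by
    intro μ
    rw [← Finset.sum_filter, Finset.filter_ne Finset.univ μ, Finset.sum_add_distrib, Finset.sum_const, Finset.card_erase_of_mem (Finset.mem_univ μ),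
      Finset.card_univ, Fintype.card_fin, nsmul_eq_mul, Finset.sum_erase_eq_sub (Finset.mem_univ μ), Nat.cast_sub P.hd]
    push_cast; ring
  rw [Finset.sum_congr rfl fun μ _ => h μ, Finset.sum_add_distrib, ← Finset.mul_sum, Finset.sum_sub_distrib, Finset.sum_const, Finset.card_univ,
    Fintype.card_fin, nsmul_eq_mul]
  ring

/-- Sums over the ordered pairs of distinct directions, as a guarded double sum. [folklore] -/
theorem sum_pairs_eq (g : Fin P.d × Fin P.d → ℝ) :
    ∑ p ∈ (Finset.univ : Finset (Fin P.d × Fin P.d)).filter (fun p => p.1 ≠ p.2), g p =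
      ∑ μ : Fin P.d, ∑ κ : Fin P.d, (if μ ≠ κ then g (μ, κ) else 0) := by
  rw [Finset.sum_filter, ← Finset.univ_product_univ, Finset.sum_product]

/-- `Σ_{(μ,κ), μ ≠ κ} (f μ + f κ) = 2(d−1)·Σ_μ f μ`, pair-set form. [folklore] -/
theorem sum_pairs_add_eq (f : Fin P.d → ℝ) :
    ∑ p ∈ (Finset.univ : Finset (Fin P.d × Fin P.d)).filter (fun p => p.1 ≠ p.2), (f p.1 + f p.2) = 2 * ((P.d : ℝ) - 1) * ∑ μ : Fin P.d, f μ := by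
  rw [sum_pairs_eq]; exact sum_ne_pair_eq f

/-- Position sums over `(x; μ ≠ κ)` are sums over the planes of sums over the sites. [folklore] -/
theorem sum_positions_eq {s : ℕ} (F : Site P s × Fin P.d × Fin P.d → ℝ) :
    ∑ q ∈ (Finset.univ : Finset (Site P s × Fin P.d × Fin P.d)).filter (fun q => q.2.1 ≠ q.2.2), F q =
      ∑ p ∈ (Finset.univ : Finset (Fin P.d × Fin P.d)).filter (fun p => p.1 ≠ p.2), ∑ x : Site P s, F (x, p.1, p.2) := by
  have hset : (Finset.univ : Finset (Site P s × Fin P.d × Fin P.d)).filter (fun q => q.2.1 ≠ q.2.2) =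
      (Finset.univ : Finset (Site P s)) ×ˢ ((Finset.univ : Finset (Fin P.d × Fin P.d)).filter (fun p => p.1 ≠ p.2)) := by
    ext q
    simp [Finset.mem_filter, Finset.mem_product]
  rw [hset, Finset.sum_product, Finset.sum_comm]

end Bookkeeping

end Summit.QuantumFields.YangMills.Theorems.FluctuationComparisonRegPrIntLS2BetaWhitneyHatCurlSq
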